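import Summits.QuantumFields.YangMills.Theorems.CovariantDischargeTruncatedPotentialZ3
import Summits.QuantumFields.YangMills.Theorems.UnitScaleTiltProp7BoxChartTransport
import Literature.MathematicalPhysics.QuantumFieldTheory.Balaban1983to89.B10StarCount
import Literature.MathematicalPhysics.QuantumFieldTheory.Balaban1983to89.T3ContinuumYM3Torus
import HarnessLib

/-!
# Line «sandwich_discharge» on crux `HistoryTailL` (stmt-QuantumFields-19936), stub `stub_sandwichSweepGapCapped` (S′), brick B5 —
# (Z-e) FILE 5 «B5 TRANSPLANTED TO THE FINE TORUS»: the truncated potential of FILE 4 pushed forward along the injective box chart `y ↦ transl c y`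
# of ✓`Prop7BoxChartTransport`, with the four rows (P)(Q)(S)(T) restated as site ∕ bond sums over `T^{(0)}` of the member `F.P K`

Cell `ym3-torus` (YM ladder rung R3 = continuum SU(2) Yang–Mills on the three-torus — a RUNG, NOT the Clay problem: not d = 4, not infinite volume,
not a mass gap); width seat `ym3-torus-px8` gen 7; `--supports stmt-QuantumFields-19936` (helper).  THEOREMS ONLY (0 `def`, default heartbeats).

★★★ `exists_truncatedPotential_torus` — with the SAME absolute constants as FILE 4: for every member `F : T3Family`, level `K`, centre `c : Site (F.P K) 0`, radius `ℓ`,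
mean-zero antisymmetric 2-form charge `ω` on `box 0 ℓ ⊆ ℤ³` (chart coordinates centred at `c`), and `R ≥ max 12 (2ℓ+4)` with the INJECTIVITY SIDE CONDITION
`2(2R+3) + 1 ≤ sitesPerDir 0` (the B6 pen discharges it from `N₁j + n ≤ K`), there is a REAL bond function `aT : PBond (F.P K) 0 → ℝ` with
* (0′) `aT b = 0` unless `b.src` is the chart image of a point of `box 0 (2R)`;
* (P′) for every `Φ : Site → Fin 3 → Fin 3 → ℝ` with `|Φ(transl c y)| ≤ θ` on `box 0 (2R+2)` (`θ ≥ 0`) and `|d₂Φ| ≤ η` on `box 0 (2R)` (alternating `d₂` along the chart):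
  `|Σ_{x : Site} Σ_{μν} CURL(aT)(x,μ,ν)·Φ(x,μ,ν) − Σ_{y ∈ box 0 (2R+2)} Σ_{μν} ω(y,μ,ν)·Φ(transl c y,μ,ν)| ≤ θ·A_S·M₁∕R + (η∕3)(A_B + A_B′(2R+ℓ))·M₀`,
  `CURL(aT)(x,μ,ν) := (aT⟨x+e_μ, ν⟩ − aT⟨x, ν⟩) − (aT⟨x+e_ν, μ⟩ − aT⟨x, μ⟩)` (the abelian instance of lit ✓`B9Eq39Adjoint.curl`'s token order, `x+e_μ = x.shift μ`);
* (Q′) `Σ_{x : Site} Σ_{μν} CURL(aT)² ≤ 328·W + A_Q·M₁²∕(R−2)⁵`;  (S′) `Σ_{b : PBond} |aT b| ≤ (A_L + A_L′(2R+1+ℓ))·M₀`;  (T′) `|aT b| ≤ A_T·M₀`.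
PROOF = FILE 4 ★`exists_truncatedPotential` at `p := 0` + ✓`exists_bond_pushforward` on `box 0 (2R+3)` + ✓`sum_site_eq_sum_box`∕✓`sum_bond_eq_sum_box` + ✓`transl_add_unitVec`
(`transl c (y + e_μ) = (transl c y).shift μ`) + lit ✓`B10StarCount.unshift_shift`.  Text-independent of the stub; restates no stub.
HONEST SCOPE: reindexing; NOTHING here proves the capped stub, `HistoryTailL`, or any summit statement; YM₃ on T³ is rung R3, not Clay. [folklore]
-/

noncomputable section

open scoped BigOperators
open Finset

namespace Summit.QuantumFields.YangMills.Theorems.CovariantDischargeTruncatedPotentialTorus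

open Literature.MathematicalPhysics.QuantumFieldTheory.Balaban1983to89
open Literature.MathematicalPhysics.QuantumFieldTheory.Balaban1983to89.T3ContinuumYM3Torus
open Literature.MathematicalPhysics.QuantumFieldTheory.Balaban1983to89.B4Eq19LatticeOperators (Zd box mem_box unitVec box_mono add_unitVec_mem_box
  sub_unitVec_mem_box)
open B10Eq27TorusAxialLog (transl)
open Summit.QuantumFields.YangMills.Theorems.PoincareLipschitzCovariantBridge (transl_add_unitVec)
open Summit.QuantumFields.YangMills.Theorems.Prop7BoxChartTransport (transl_injOn_box sum_site_eq_sum_box sum_bond_eq_sum_box exists_bond_pushforward)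
open Summit.QuantumFields.YangMills.Theorems.CovariantDischargeTruncatedPotentialZ3 (exists_truncatedPotential)

/-! ## §1 Chart bookkeeping -/

/-- If `x + e_μ` is the chart image of `y′`, then `x` is the chart image of `y′ − e_μ`. [folklore] -/
theorem eq_transl_sub_of_shift_eq {F : T3Family} {K : ℕ} (c : Site (F.P K) 0) {x : Site (F.P K) 0} {y' : Zd (F.P K).d} {μ : Fin (F.P K).d}
    (h : x.shift μ = transl c y') : x = transl c (y' - unitVec μ) := by
  have h1 : transl c (y' - unitVec μ + unitVec μ) = (transl c (y' - unitVec μ)).shift μ := transl_add_unitVec c (y' - unitVec μ) μ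
  rw [sub_add_cancel] at h1
  have h2 : (x.shift μ).unshift μ = (transl c y').unshift μ := by rw [h]
  rw [B10StarCount.unshift_shift, h1, B10StarCount.unshift_shift] at h2
  exact h2

/-- A point off the chart image of `box 0 r` whose shift lands in the image of `box 0 r'` lands on a point OUTSIDE `box 0 (r − 1)`. [folklore] -/
theorem not_mem_box_of_shift_eq {F : T3Family} {K : ℕ} (c : Site (F.P K) 0) {x : Site (F.P K) 0} {r : ℤ}
    (hx : ∀ y ∈ box (0 : Zd (F.P K).d) r, transl c y ≠ x) {y' : Zd (F.P K).d} {μ : Fin (F.P K).d} (h : x.shift μ = transl c y') :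
    y' ∉ box (0 : Zd (F.P K).d) (r - 1) := by
  intro hy'
  have hx' := eq_transl_sub_of_shift_eq c h
  have hmem : y' - unitVec μ ∈ box (0 : Zd (F.P K).d) r := by
    have := sub_unitVec_mem_box hy' μ
    rwa [sub_add_cancel] at this
  exact hx _ hmem hx'.symm

/-! ## §2 B5 on the fine torus -/

/-- ★★★ **B5 TRANSPLANTED TO THE FINE TORUS** — see the module docstring. [folklore] -/
theorem exists_truncatedPotential_torus : ∃ A_S A_B A_B' A_Q A_L A_L' A_T : ℝ,
    0 ≤ A_S ∧ 0 ≤ A_B ∧ 0 ≤ A_B' ∧ 0 ≤ A_Q ∧ 0 ≤ A_L ∧ 0 ≤ A_L' ∧ 0 ≤ A_T ∧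
    ∀ (F : T3Family) (K : ℕ) (c : Site (F.P K) 0) (ℓ R : ℕ) (ω : Zd 3 → Fin 3 → Fin 3 → ℝ),
      (∀ x, x ∉ box (0 : Zd 3) (ℓ : ℤ) → ∀ μ ν, ω x μ ν = 0) → (∀ x μ ν, ω x ν μ = -ω x μ ν) →
      (∀ μ ν, ∑ y ∈ box (0 : Zd 3) (ℓ : ℤ), ω y μ ν = 0) →
      2 * ℓ + 4 ≤ R → 12 ≤ R → 2 * (2 * (R : ℤ) + 3) + 1 ≤ ((F.P K).sitesPerDir 0 : ℤ) →
      ∃ aT : PBond (F.P K) 0 → ℝ,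
        (∀ b : PBond (F.P K) 0, (∀ y ∈ box (0 : Zd 3) (2 * (R : ℤ)), transl c y ≠ b.src) → aT b = 0) ∧
        (∀ (Φ : Site (F.P K) 0 → Fin 3 → Fin 3 → ℝ) (θ η : ℝ), 0 ≤ θ →
          (∀ y ∈ box (0 : Zd 3) (2 * (R : ℤ) + 2), ∀ μ ν, |Φ (transl c y) μ ν| ≤ θ) →
          (∀ y ∈ box (0 : Zd 3) (2 * (R : ℤ)), ∀ κ μ ν,
            |(Φ (transl c (y + unitVec κ)) μ ν - Φ (transl c y) μ ν) - (Φ (transl c (y + unitVec μ)) κ ν - Φ (transl c y) κ ν)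
              + (Φ (transl c (y + unitVec ν)) κ μ - Φ (transl c y) κ μ)| ≤ η) →
          |(∑ x : Site (F.P K) 0, ∑ μ, ∑ ν, ((aT ⟨x.shift μ, ν⟩ - aT ⟨x, ν⟩) - (aT ⟨x.shift ν, μ⟩ - aT ⟨x, μ⟩)) * Φ x μ ν)
              - ∑ y ∈ box (0 : Zd 3) (2 * (R : ℤ) + 2), ∑ μ, ∑ ν, ω y μ ν * Φ (transl c y) μ ν|
            ≤ θ * (A_S * (∑ μ, ∑ ν, ∑ y ∈ box (0 : Zd 3) (ℓ : ℤ), (∑ i, |((y i - (0 : Zd 3) i : ℤ) : ℝ)|) * |ω y μ ν|) / R)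
              + η / 3 * ((A_B + A_B' * (2 * (R : ℝ) + ℓ)) * ∑ μ, ∑ ν, ∑ y ∈ box (0 : Zd 3) (ℓ : ℤ), |ω y μ ν|)) ∧
        (∑ x : Site (F.P K) 0, ∑ μ, ∑ ν, ((aT ⟨x.shift μ, ν⟩ - aT ⟨x, ν⟩) - (aT ⟨x.shift ν, μ⟩ - aT ⟨x, μ⟩)) ^ 2
            ≤ 328 * (∑ μ, ∑ ν, ∑ y ∈ box (0 : Zd 3) (ℓ : ℤ), ω y μ ν ^ 2)
              + A_Q * (∑ μ, ∑ ν, ∑ y ∈ box (0 : Zd 3) (ℓ : ℤ), (∑ i, |((y i - (0 : Zd 3) i : ℤ) : ℝ)|) * |ω y μ ν|) ^ 2 / ((R : ℝ) - 2) ^ 5) ∧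
        (∑ b : PBond (F.P K) 0, |aT b| ≤ (A_L + A_L' * (2 * (R : ℝ) + 1 + ℓ)) * ∑ μ, ∑ ν, ∑ y ∈ box (0 : Zd 3) (ℓ : ℤ), |ω y μ ν|) ∧
        (∀ b : PBond (F.P K) 0, |aT b| ≤ A_T * ∑ μ, ∑ ν, ∑ y ∈ box (0 : Zd 3) (ℓ : ℤ), |ω y μ ν|) := by
  obtain ⟨A_S, A_B, A_B', A_Q, A_L, A_L', A_T, hS, hB, hB', hQ, hL, hL', hT, hmain⟩ := exists_truncatedPotential
  refine ⟨A_S, A_B, A_B', A_Q, A_L, A_L', A_T, hS, hB, hB', hQ, hL, hL', hT, ?_⟩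
  intro F K c ℓ R ω hω0 hωanti hω1 hR hR12 hN
  obtain ⟨aR, h0, hP, hQ', hS', hT'⟩ := hmain (0 : Zd 3) ℓ R ω hω0 hωanti hω1 hR hR12
  obtain ⟨M₀, hM₀⟩ : ∃ M : ℝ, M = ∑ μ, ∑ ν, ∑ y ∈ box (0 : Zd 3) (ℓ : ℤ), |ω y μ ν| := ⟨_, rfl⟩
  have hM₀0 : 0 ≤ M₀ := by
    rw [hM₀]; exact Finset.sum_nonneg fun _ _ => Finset.sum_nonneg fun _ _ => Finset.sum_nonneg fun _ _ => abs_nonneg _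
  rw [← hM₀] at hP hS' hT' ⊢
  -- push `aR` forward along the chart of `box 0 (2R+3)`
  have hN3 : 2 * (2 * (R : ℤ) + 3) + 1 ≤ ((F.P K).sitesPerDir 0 : ℤ) := hN
  obtain ⟨aT, haT, haT0⟩ := exists_bond_pushforward (P := F.P K) (j := 0) c (z := (0 : Zd 3)) (R := 2 * (R : ℤ) + 3) hN3 aR
  -- the push-forward vanishes off the image of `box 0 (2R)`
  have hval : ∀ (x : Site (F.P K) 0) (ν : Fin 3), (∀ y ∈ box (0 : Zd 3) (2 * (R : ℤ)), transl c y ≠ x) → aT ⟨x, ν⟩ = 0 := by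
    intro x ν hx
    by_cases him : ∃ y ∈ box (0 : Zd 3) (2 * (R : ℤ) + 3), transl c y = x
    · obtain ⟨y, hy, rfl⟩ := him
      rw [haT y hy ν]
      exact h0 y (fun hy2 => hx y hy2 rfl) ν
    · simp only [not_exists, not_and] at him
      exact haT0 ⟨x, ν⟩ fun y hy => him y hy
  -- the curl summand at a non-image point vanishes
  have hcurl0 : ∀ (x : Site (F.P K) 0), (∀ y ∈ box (0 : Zd 3) (2 * (R : ℤ) + 2), transl c y ≠ x) →
      ∀ μ ν : Fin 3, (aT ⟨x.shift μ, ν⟩ - aT ⟨x, ν⟩) - (aT ⟨x.shift ν, μ⟩ - aT ⟨x, μ⟩) = 0 := by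
    intro x hx μ ν
    have hx' : ∀ y ∈ box (0 : Zd 3) (2 * (R : ℤ)), transl c y ≠ x := fun y hy => hx y (box_mono 0 (by linarith) hy)
    have hsh : ∀ κ τ : Fin 3, aT ⟨x.shift κ, τ⟩ = 0 := by
      intro κ τ
      refine hval (x.shift κ) τ fun y' hy' h => ?_
      have := not_mem_box_of_shift_eq c hx h.symm
      exact this (box_mono 0 (by linarith) hy')
    rw [hsh, hsh, hval x ν hx', hval x μ hx']; ring
  -- the curl summand at a chart point
  have hcurl : ∀ y ∈ box (0 : Zd 3) (2 * (R : ℤ) + 2), ∀ μ ν : Fin 3,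
      (aT ⟨(transl c y).shift μ, ν⟩ - aT ⟨transl c y, ν⟩) - (aT ⟨(transl c y).shift ν, μ⟩ - aT ⟨transl c y, μ⟩)
        = (aR (y + unitVec μ) ν - aR y ν) - (aR (y + unitVec ν) μ - aR y μ) := by
    intro y hy μ ν
    have hy3 : y ∈ box (0 : Zd 3) (2 * (R : ℤ) + 3) := box_mono 0 (by linarith) hy
    have hyμ : y + unitVec μ ∈ box (0 : Zd 3) (2 * (R : ℤ) + 3) := by
      have := add_unitVec_mem_box hy μ; rwa [show 2 * (R : ℤ) + 2 + 1 = 2 * (R : ℤ) + 3 by ring] at this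
    have hyν : y + unitVec ν ∈ box (0 : Zd 3) (2 * (R : ℤ) + 3) := by
      have := add_unitVec_mem_box hy ν; rwa [show 2 * (R : ℤ) + 2 + 1 = 2 * (R : ℤ) + 3 by ring] at this
    have e1 : aT ⟨(transl c y).shift μ, ν⟩ = aR (y + unitVec μ) ν := by
      have h := haT _ hyμ ν; erw [transl_add_unitVec] at h; exact h
    have e2 : aT ⟨(transl c y).shift ν, μ⟩ = aR (y + unitVec ν) μ := by
      have h := haT _ hyν μ; erw [transl_add_unitVec] at h; exact h
    have e3 : aT ⟨transl c y, ν⟩ = aR y ν := haT _ hy3 ν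
    have e4 : aT ⟨transl c y, μ⟩ = aR y μ := haT _ hy3 μ
    rw [e1, e2, e3, e4]
  have hN2 : 2 * (2 * (R : ℤ) + 2) + 1 ≤ ((F.P K).sitesPerDir 0 : ℤ) := by linarith
  refine ⟨aT, fun b hb => hval b.src b.dir hb, ?_, ?_, ?_, ?_⟩
  · -- (P′)
    intro Φ θ η hθ hΦ hdΦ
    have hsum : ∑ x : Site (F.P K) 0, ∑ μ, ∑ ν, ((aT ⟨x.shift μ, ν⟩ - aT ⟨x, ν⟩) - (aT ⟨x.shift ν, μ⟩ - aT ⟨x, μ⟩)) * Φ x μ ν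
        = ∑ y ∈ box (0 : Zd 3) (2 * (R : ℤ) + 2), ∑ μ, ∑ ν, ((aR (y + unitVec μ) ν - aR y ν) - (aR (y + unitVec ν) μ - aR y μ)) * Φ (transl c y) μ ν := by
      rw [sum_site_eq_sum_box c hN2 _ (fun x hx => by simp only [hcurl0 x hx, zero_mul, Finset.sum_const_zero])]
      exact Finset.sum_congr rfl fun y hy => Finset.sum_congr rfl fun μ _ => Finset.sum_congr rfl fun ν _ => by rw [hcurl y hy μ ν]
    rw [hsum]
    exact hP (fun y μ ν => Φ (transl c y) μ ν)
      (fun y κ μ ν => (Φ (transl c (y + unitVec κ)) μ ν - Φ (transl c y) μ ν) - (Φ (transl c (y + unitVec μ)) κ ν - Φ (transl c y) κ ν)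
        + (Φ (transl c (y + unitVec ν)) κ μ - Φ (transl c y) κ μ))
      (fun _ _ _ _ => rfl) θ η hθ hΦ hdΦ
  · -- (Q′)
    rw [sum_site_eq_sum_box c hN2 _ (fun x hx => by simp only [hcurl0 x hx, zero_pow two_ne_zero, Finset.sum_const_zero])]
    calc ∑ y ∈ box (0 : Zd 3) (2 * (R : ℤ) + 2), ∑ μ, ∑ ν, ((aT ⟨(transl c y).shift μ, ν⟩ - aT ⟨transl c y, ν⟩)
          - (aT ⟨(transl c y).shift ν, μ⟩ - aT ⟨transl c y, μ⟩)) ^ 2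
        = ∑ y ∈ box (0 : Zd 3) (2 * (R : ℤ) + 2), ∑ μ, ∑ ν, ((aR (y + unitVec μ) ν - aR y ν) - (aR (y + unitVec ν) μ - aR y μ)) ^ 2 :=
          Finset.sum_congr rfl fun y hy => Finset.sum_congr rfl fun μ _ => Finset.sum_congr rfl fun ν _ => by rw [hcurl y hy μ ν]
      _ ≤ _ := hQ' _
  · -- (S′)
    rw [sum_bond_eq_sum_box c hN3 (fun b => |aT b|) (fun b hb => by
      rw [hval b.src b.dir (fun y hy => hb y (box_mono 0 (by linarith) hy)), abs_zero])]
    calc ∑ y ∈ box (0 : Zd 3) (2 * (R : ℤ) + 3), ∑ μ, |aT ⟨transl c y, μ⟩|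
        = ∑ y ∈ box (0 : Zd 3) (2 * (R : ℤ) + 3), ∑ μ, |aR y μ| :=
          Finset.sum_congr rfl fun y hy => Finset.sum_congr rfl fun μ _ => by rw [haT y hy μ]
      _ ≤ _ := hS' _
  · -- (T′)
    intro b
    by_cases him : ∃ y ∈ box (0 : Zd 3) (2 * (R : ℤ) + 3), transl c y = b.src
    · obtain ⟨y, hy, hyb⟩ := him
      have : aT b = aR y b.dir := by
        have := haT y hy b.dir; rw [hyb] at this; exact this
      rw [this]; exact hT' y b.dir
    · simp only [not_exists, not_and] at him
      rw [haT0 b fun y hy => him y hy, abs_zero]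
      exact mul_nonneg hT hM₀0

end Summit.QuantumFields.YangMills.Theorems.CovariantDischargeTruncatedPotentialTorus

end
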